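import Mathlib
import HarnessLib
import HarnessLib.Audit
import Summits.Langlands.Langlands.Theorems.OddPrimeDoorSplitPrelude

/-!
# OddPrimeDoorSplit (§4 kernel, §5 compositions; dials and pieces in `OddPrimeDoorSplitPrelude`) — lens-5 g30 node on RES = `DyadicDoorSplit.DyadicDegenerateResidual` (and on its four g29 pieces)

TARGET (tree decl, BY NAME): RES = `Summit.Langlands.Langlands.Theorems.DyadicDoorSplit.DyadicDegenerateResidual`
(g28, `Theorems/DyadicDoorSplitPrelude.lean`): every integral `E` (`Δ ≠ 0`) over an UNANCHORED totally real field
`K₀` of degree `≥ 6` (`DepthIsolationSplit.UnanchoredBox K₀`), of residual moduli degree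
(`JDegreeFilterSplit.InResidualRange K₀ E`), OFF the Allen locus, is modular.  Lineage: REST (stmt-Langlands-26998)
→ REST_E (g26) → LJR (g27) → ADS ∧ RES (g28) → F2T ∧ R₂⁻ ∧ R_ss⁻ ∧ R_cm⁶ (g29, `TwoDivisionFieldSplit`, prime `2`
exhausted: on the whole 2-degenerate residual `ρ̄_{E,2}` is reducible and no printed theorem applies).

THESIS OF THE CUT (lens 5 «finite/base range + asymptotic regime + bridge», read at the ODD torsion primes
`p ∈ {3, 5, 7}` — the primes at which printed modularity lifting needs no hypothesis on the totally real field):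
* GENERIC REGIME (door 1, CLOSED BY NAME): `Generic357 K₀ E` — for some `p ∈ {3,5,7}` the image
  `ρ̄_{E,p}(G_{K₀(ζ_p)})` is absolutely irreducible (tree carrier `ModPImageAbsIrreducibleOverCyclotomic`).
  Freitas–Le Hung–Siksek 2015, Thms. 3–4 (tree NAMED FACT `FLS2015_theorems3_4`, stated for EVERY totally real
  field; `FLS2015_theorems3_4.isModularEllipticCurve`) decide modularity there: `genericSector_closed`.
* FINITE RANGE: off door 1, for EACH `p ∈ {3,5,7}` some framing of `E[p]` is Borel-, split-Cartan-normaliser- or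
  non-split-Cartan-normaliser-valued (tree theorem `FLS2015.levelStructure_of_not_modPImageAbsIrreducibleOverCyclotomic`,
  re-exported on the dial as `levelStructures_of_not_generic`; at `p = 3` sharpened by the PROVED Prop. 9.1 (a):
  reducible or image `= C_s⁺(3)`, `mod3_dichotomy_of_not_generic`) — i.e. `j(E)` is a `K₀`-point of one of the
  27 curves `X(u,v,w)` of FLS §7 (finitely many `j` per field by Faltings; ineffective, hence NOT a closing).
* BRIDGE (door 2, a PRINT CHAIN not yet in the tree, typed E-level and model-invariantly as ONE junction
  `SkinnerWilesDihedralDoor`): on the sub-locus `SWLocus K₀ E p` — `ρ̄_{E,p}` absolutely irreducible for every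
  framing, NOT generic at `p` (so `ρ̄_{E,p}` is induced from the quadratic subfield of `K₀(ζ_p)/K₀`: dihedral),
  `v(j) < 0` at every `v ∣ p` (potentially multiplicative, hence `ρ_{E,p}|_{D_v} ≃ (τε *; 0 τ)` nearly ordinary with
  `τ` quadratic) and `μ_p ⊄ K₀ᵥ` at every `v ∣ p` (so `ε̄ ≠ 1` on `D_v`: `ρ̄` is `D_v`-distinguished) —
  Skinner–Wiles 2001 (Ann. Fac. Sci. Toulouse (6) 10, Thm. 5.1, p. 204: `F` ANY totally real field, `p` odd,
  no Taylor–Wiles hypothesis) + a `χ₂`-good nearly-ordinary automorphic lift of `ρ̄` (theta series of the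
  inducing character and its ordinary Hida-family members of weight `≥ 2`: Hecke / Jacquet–Langlands, Wiles 1988,
  Hida 1989) give modularity: `swSector_closed`.
* BRIDGE' (door 3, a PRINT CHAIN not yet in the tree, ONE junction `PanZhangSupersingularDoor`): on the sub-locus
  `PZLocus K₀ E p` — `p` TOTALLY SPLIT in `K₀` (`K₀ᵥ = ℚ_p`), `ρ̄_{E,p}` absolutely irreducible for every framing,
  `v(j − j_ss(p)) > 0` at every `v ∣ p` (potentially supersingular, so `ρ_{E,p}|_{G_{ℚ_p}}` is absolutely
  irreducible) — X. Zhang 2024, Thm. 6.1.1 (arXiv:2412.06812 p. 33, after L. Pan 2022: `p` odd completely split in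
  `F`, NO hypothesis on `ρ̄|G_{F(ζ_p)}`) + residual automorphy of the (generic or dihedral) `ρ̄_{E,p}` give
  modularity: `pzSector_closed`.  (This is the cell-lineage, E-level form of the two printed doors used ρ-level at
  `p = 3` on the host's `C_s⁺(3)` crux by the line `Cruxes/SplitCartanThreeAutomorphic/Lines/threelocal`.)
* RESIDUAL (declared, IDEA-NEEDED): `CoreResidual` = RES restricted to `OffDoors K₀ E` (no door), and the
  same restriction `…Core` of each g29 piece.  EXACTNESS: `residual_iff_core`, `fullTwoTorsion_iff_core`, … .

KERNEL THEOREMS (no `sorry`): pointwise `modular_of_offDoors` (FLS34 → SWD → PZD → (OffDoors → modular) → modular);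
RES ⟸ FLS34 ∧ SWD ∧ PZD ∧ CoreResidual (`residual_of_core`) and RES ⟹ CoreResidual (`core_of_residual`); the same for
F2T, R₂⁻, R_ss⁻, R_cm⁶; the finite-range certificates; compositions BY NAME up to LJR (`largeJResidual_of_core`,
through g28's `largeJResidual_of_sectors`), REST_E (`restE_of_core`) and REST = stmt-Langlands-26998
(`closes_target`, `closes_byName`, through `JDegreeFilterSplit.closes_target`); necessity `core_of_largeJResidual`,
`core_of_restE`.  No `instance`, no `notation`; every dial is a property of `j(E)`, of the Galois module `E[p]`
or of the field `K₀` (model-invariant).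

References: [FreitasLeHungSiksek2015] arXiv:1310.7088, Thms. 3, 4 (p. 4), Prop. 3.1, Prop. 9.1 (a), §7;
[SkinnerWiles2001] C. Skinner, A. Wiles, *Nearly ordinary deformations of irreducible residual representations*,
Ann. Fac. Sci. Toulouse Math. (6) 10 (2001) 185–215, doi:10.5802/afst.988, (5.1) p. 203 and Thm. 5.1 p. 204;
[Allen2014] arXiv:1301.1113 p. 3 (SW removed the Taylor–Wiles hypothesis in the ordinary case); [Thorne2016]
arXiv:1504.00994, p. 3; [Wiles1988] Invent. Math. 94, 529–573; [Hida1989] nearly ordinary Hecke algebras over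
totally real fields; [XZhang2024] X. Zhang, *On the Fontaine–Mazur conjecture for p = 3*, arXiv:2412.06812, Thm. 6.1.1
(p. 33) and Remark 6.1.2; [Pan2022] L. Pan, *The Fontaine–Mazur conjecture in the residually reducible case*,
J. Amer. Math. Soc. 35 (2022), arXiv:1901.07166, Thms. 1.0.2, 1.0.4.
-/

set_option linter.dupNamespace false
set_option linter.unusedVariables false

open scoped NumberField IntermediateField ComplexConjugate MatrixGroups
open NumberField IsDedekindDomain Field Literature.NumberTheory.Automorphic
open Literature.NumberTheory.GaloisRepresentations
open Summit.Langlands.Langlands.Theorems.DepthIsolationSplit (UnanchoredBox UnanchoredHighDegreeModularE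
  IntegralModelTransferPointwise SatakeAvatarTwo satakeAvatarTwo_of_host)
open Summit.Langlands.Langlands.Theorems.JDegreeFilterSplit (jInv jDeg InResidualRange LargeJResidual
  RatBaseChangeModularity SmallFieldBaseChange SolvableDescentModularity restE_of_jLeaves largeJResidual_of_restE)
open Summit.Langlands.Langlands.Theorems.DyadicDoorSplit (disc NoRationalTwoTorsion AllenLocus AllenDyadicCorollary
  AllenDoorSector DyadicDegenerateResidual not_allenLocus_iff largeJResidual_of_sectors allenDoorSector_of_corollary
  residual_of_largeJResidual)
open Summit.Langlands.Langlands.Theorems.TwoDivisionFieldSplit (FullTwoTorsion FullTwoTorsionResidual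
  MixedSignTwoTorsionResidual NegativePlaceSupersingularResidual IrreducibleCMComponentResidual pieces_of_residual
  exists_root_of_fullTwoTorsion)

namespace Summit.Langlands.Langlands.Theorems.OddPrimeDoorSplit

/-! ## §4 Kernel: the pointwise door lemma, exactness, the finite-range certificates -/

/-- THE DOOR LEMMA (pointwise): under FLS Thms. 3–4, SWD and PZD, a curve that is modular OFF the doors is modular. -/
theorem modular_of_offDoors (h34 : FLS2015_theorems3_4) (hSW : SkinnerWilesDihedralDoor)
    (hPZ : PanZhangSupersingularDoor)
    (K₀ : Type) [Field K₀] [NumberField K₀] [IsTotallyReal K₀] (E : WeierstrassCurve (𝓞 K₀)) (hΔ : E.Δ ≠ 0)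
    (hcore : OffDoors K₀ E → IsModularEllipticCurve K₀ E) : IsModularEllipticCurve K₀ E := by
  by_cases hg : Generic357 K₀ E
  · obtain ⟨p, hp, h357, himg⟩ := hg
    haveI : Fact p.Prime := ⟨hp⟩
    exact h34.isModularEllipticCurve K₀ hΔ p h357 himg
  · by_cases hs : OnSWDoor K₀ E
    · obtain ⟨p, hp, h357, hloc⟩ := hs
      haveI : Fact p.Prime := ⟨hp⟩
      exact hSW K₀ E hΔ p h357 hloc
    · by_cases hz : OnPZDoor K₀ E
      · obtain ⟨p, hp, h357, hloc⟩ := hz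
        haveI : Fact p.Prime := ⟨hp⟩
        exact hPZ K₀ E hΔ p h357 hloc
      · exact hcore ⟨hg, hs, hz⟩

/-- GEN is CLOSED from the tree's named fact FLS Thms. 3–4 (stated for every totally real field). -/
theorem genericSector_closed (h34 : FLS2015_theorems3_4) : GenericSector := by
  intro K₀ _ _ hb E hΔ _ _ hg
  haveI : IsTotallyReal K₀ := hb.1
  obtain ⟨p, hp, h357, himg⟩ := hg
  haveI : Fact p.Prime := ⟨hp⟩
  exact h34.isModularEllipticCurve K₀ hΔ p h357 himg

/-- SW is CLOSED from the junction SWD. -/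
theorem swSector_closed (hSW : SkinnerWilesDihedralDoor) : SWSector := by
  intro K₀ _ _ hb E hΔ _ _ hs
  haveI : IsTotallyReal K₀ := hb.1
  obtain ⟨p, hp, h357, hloc⟩ := hs
  haveI : Fact p.Prime := ⟨hp⟩
  exact hSW K₀ E hΔ p h357 hloc

/-- PZ is CLOSED from the junction PZD. -/
theorem pzSector_closed (hPZ : PanZhangSupersingularDoor) : PZSector := by
  intro K₀ _ _ hb E hΔ _ _ hz
  haveI : IsTotallyReal K₀ := hb.1
  obtain ⟨p, hp, h357, hloc⟩ := hz
  haveI : Fact p.Prime := ⟨hp⟩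
  exact hPZ K₀ E hΔ p h357 hloc

/-- SUFFICIENCY: RES ⟸ FLS34 ∧ SWD ∧ PZD ∧ CORE. -/
theorem residual_of_core (h34 : FLS2015_theorems3_4) (hSW : SkinnerWilesDihedralDoor)
    (hPZ : PanZhangSupersingularDoor) (hC : CoreResidual) : DyadicDegenerateResidual := by
  intro K₀ _ _ hb E hΔ hr hA
  haveI : IsTotallyReal K₀ := hb.1
  exact modular_of_offDoors h34 hSW hPZ K₀ E hΔ (hC K₀ hb E hΔ hr hA)

/-- NECESSITY: RES ⟹ CORE (CORE is a sub-locus). -/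
theorem core_of_residual (h : DyadicDegenerateResidual) : CoreResidual :=
  fun K₀ _ _ hb E hΔ hr hA _ => h K₀ hb E hΔ hr hA

/-- EXACTNESS: modulo the two doors, RES ⟺ CORE. -/
theorem residual_iff_core (h34 : FLS2015_theorems3_4) (hSW : SkinnerWilesDihedralDoor)
    (hPZ : PanZhangSupersingularDoor) : DyadicDegenerateResidual ↔ CoreResidual :=
  ⟨core_of_residual, residual_of_core h34 hSW hPZ⟩

/-- RES ⟺ GEN ∧ EXC (excluded middle on door 1), and GEN is closed: RES ⟸ FLS34 ∧ EXC. -/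
theorem residual_of_exceptional (h34 : FLS2015_theorems3_4) (hX : ExceptionalResidual) :
    DyadicDegenerateResidual := by
  intro K₀ _ _ hb E hΔ hr hA
  by_cases hg : Generic357 K₀ E
  · exact genericSector_closed h34 K₀ hb E hΔ hr hA hg
  · exact hX K₀ hb E hΔ hr hA hg

/-- RES ⟹ EXC. -/
theorem exceptional_of_residual (h : DyadicDegenerateResidual) : ExceptionalResidual :=
  fun K₀ _ _ hb E hΔ hr hA _ => h K₀ hb E hΔ hr hA

/-- EXC ⟸ SWD ∧ PZD ∧ CORE (excluded middle on doors 2 and 3). -/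
theorem exceptional_of_core (hSW : SkinnerWilesDihedralDoor) (hPZ : PanZhangSupersingularDoor)
    (hC : CoreResidual) : ExceptionalResidual := by
  intro K₀ _ _ hb E hΔ hr hA hg
  by_cases hs : OnSWDoor K₀ E
  · exact swSector_closed hSW K₀ hb E hΔ hr hA hs
  · by_cases hz : OnPZDoor K₀ E
    · exact pzSector_closed hPZ K₀ hb E hΔ hr hA hz
    · exact hC K₀ hb E hΔ hr hA ⟨hg, hs, hz⟩

/-- EXC ⟹ CORE. -/
theorem core_of_exceptional (h : ExceptionalResidual) : CoreResidual :=
  fun K₀ _ _ hb E hΔ hr hA hoff => h K₀ hb E hΔ hr hA hoff.1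

/-- F2T ⟸ FLS34 ∧ SWD ∧ PZD ∧ F2T_core. -/
theorem fullTwoTorsion_of_core (h34 : FLS2015_theorems3_4) (hSW : SkinnerWilesDihedralDoor)
    (hPZ : PanZhangSupersingularDoor) (hC : FullTwoTorsionCore) : FullTwoTorsionResidual := by
  intro K₀ _ _ hb E hΔ hr hft
  haveI : IsTotallyReal K₀ := hb.1
  exact modular_of_offDoors h34 hSW hPZ K₀ E hΔ (hC K₀ hb E hΔ hr hft)

/-- F2T ⟹ F2T_core. -/
theorem core_of_fullTwoTorsion (h : FullTwoTorsionResidual) : FullTwoTorsionCore :=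
  fun K₀ _ _ hb E hΔ hr hft _ => h K₀ hb E hΔ hr hft

/-- F2T ⟺ F2T_core modulo the doors. -/
theorem fullTwoTorsion_iff_core (h34 : FLS2015_theorems3_4) (hSW : SkinnerWilesDihedralDoor)
    (hPZ : PanZhangSupersingularDoor) : FullTwoTorsionResidual ↔ FullTwoTorsionCore :=
  ⟨core_of_fullTwoTorsion, fullTwoTorsion_of_core h34 hSW hPZ⟩

/-- R₂⁻ ⟸ FLS34 ∧ SWD ∧ PZD ∧ R₂⁻_core. -/
theorem mixedSign_of_core (h34 : FLS2015_theorems3_4) (hSW : SkinnerWilesDihedralDoor)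
    (hPZ : PanZhangSupersingularDoor) (hC : MixedSignTwoTorsionCore) : MixedSignTwoTorsionResidual := by
  intro K₀ _ _ hb E hΔ hr hx hσ
  haveI : IsTotallyReal K₀ := hb.1
  exact modular_of_offDoors h34 hSW hPZ K₀ E hΔ (hC K₀ hb E hΔ hr hx hσ)

/-- R₂⁻ ⟹ R₂⁻_core. -/
theorem core_of_mixedSign (h : MixedSignTwoTorsionResidual) : MixedSignTwoTorsionCore :=
  fun K₀ _ _ hb E hΔ hr hx hσ _ => h K₀ hb E hΔ hr hx hσ

/-- R_ss⁻ ⟸ FLS34 ∧ SWD ∧ PZD ∧ R_ss⁻_core. -/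
theorem supersingular_of_core (h34 : FLS2015_theorems3_4) (hSW : SkinnerWilesDihedralDoor)
    (hPZ : PanZhangSupersingularDoor) (hC : NegativePlaceSupersingularCore) : NegativePlaceSupersingularResidual := by
  intro K₀ _ _ hb E hΔ hr hnt hv hσ
  haveI : IsTotallyReal K₀ := hb.1
  exact modular_of_offDoors h34 hSW hPZ K₀ E hΔ (hC K₀ hb E hΔ hr hnt hv hσ)

/-- R_ss⁻ ⟹ R_ss⁻_core. -/
theorem core_of_supersingular (h : NegativePlaceSupersingularResidual) : NegativePlaceSupersingularCore :=
  fun K₀ _ _ hb E hΔ hr hnt hv hσ _ => h K₀ hb E hΔ hr hnt hv hσ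

/-- R_cm⁶ ⟸ FLS34 ∧ SWD ∧ PZD ∧ R_cm⁶_core. -/
theorem cm_of_core (h34 : FLS2015_theorems3_4) (hSW : SkinnerWilesDihedralDoor)
    (hPZ : PanZhangSupersingularDoor) (hC : IrreducibleCMComponentCore) : IrreducibleCMComponentResidual := by
  intro K₀ _ _ hb E hΔ hr hnt hneg hsq
  haveI : IsTotallyReal K₀ := hb.1
  exact modular_of_offDoors h34 hSW hPZ K₀ E hΔ (hC K₀ hb E hΔ hr hnt hneg hsq)

/-- R_cm⁶ ⟹ R_cm⁶_core. -/
theorem core_of_cm (h : IrreducibleCMComponentResidual) : IrreducibleCMComponentCore :=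
  fun K₀ _ _ hb E hΔ hr hnt hneg hsq _ => h K₀ hb E hΔ hr hnt hneg hsq

/-- CORE ⟹ the four piece cores (CORE is their union, pointwise; g29's `pieces_of_residual` BY NAME pattern). -/
theorem pieceCores_of_core (hC : CoreResidual) :
    FullTwoTorsionCore ∧ MixedSignTwoTorsionCore ∧ NegativePlaceSupersingularCore ∧ IrreducibleCMComponentCore := by
  refine ⟨?_, ?_, ?_, ?_⟩
  · intro K₀ _ _ hb E hΔ hr hft hoff
    exact hC K₀ hb E hΔ hr ((not_allenLocus_iff K₀ E).2 (Or.inl (exists_root_of_fullTwoTorsion K₀ E hft))) hoff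
  · intro K₀ _ _ hb E hΔ hr hx hneg hoff
    exact hC K₀ hb E hΔ hr ((not_allenLocus_iff K₀ E).2 (Or.inl hx)) hoff
  · intro K₀ _ _ hb E hΔ hr hT hv hneg hoff
    exact hC K₀ hb E hΔ hr ((not_allenLocus_iff K₀ E).2 (Or.inr (Or.inr (Or.inl hv)))) hoff
  · intro K₀ _ _ hb E hΔ hr hT hneg hall hoff
    exact hC K₀ hb E hΔ hr ((not_allenLocus_iff K₀ E).2 (Or.inr (Or.inr (Or.inr ⟨hneg, hall⟩)))) hoff

/-! ### The finite range: what "off door 1" certifies (FLS Prop. 3.1 (ii), Prop. 9.1 (a) — tree theorems) -/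

/-- Off door 1, at EACH `p ∈ {3, 5, 7}` some framing of `E[p]` is Borel-, `C_s⁺`- or `C_ns⁺`-valued: the
finite list of level structures (tree theorem `FLS2015.levelStructure_of_not_modPImageAbsIrreducibleOverCyclotomic`
applied on the dial). [cite: FreitasLeHungSiksek2015, Prop. 3.1 (ii)] -/
theorem levelStructures_of_not_generic {K₀ : Type} [Field K₀] [NumberField K₀] (E : WeierstrassCurve (𝓞 K₀))
    (hΔ : E.Δ ≠ 0) (hng : ¬ Generic357 K₀ E) (p : ℕ) [Fact p.Prime] (hp : p = 3 ∨ p = 5 ∨ p = 7) :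
    ∃ ρ' : FramedGaloisRep K₀ (ZMod p) 2, (E.baseChange K₀).IsTorsionGaloisRep p ρ' ∧
      ((∀ σ : absoluteGaloisGroup K₀,
          ((ρ' σ : GL (Fin 2) (ZMod p)) : Matrix (Fin 2) (Fin 2) (ZMod p)) 1 0 = 0) ∨
        (∃ P : GL (Fin 2) (ZMod p), ∀ σ : absoluteGaloisGroup K₀,
          ρ' σ ∈ Subgroup.normalizer (Serre1972.splitCartan P : Set (GL (Fin 2) (ZMod p)))) ∨
        (∃ k : Subalgebra (ZMod p) (Matrix (Fin 2) (Fin 2) (ZMod p)),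
          IsField k ∧ Module.finrank (ZMod p) k = 2 ∧ ∀ σ : absoluteGaloisGroup K₀,
            ρ' σ ∈ Subgroup.normalizer (Serre1972.unitGroup k : Set (GL (Fin 2) (ZMod p))))) := by
  have hp2 : p ≠ 2 := by rcases hp with rfl | rfl | rfl <;> decide
  refine FLS2015.levelStructure_of_not_modPImageAbsIrreducibleOverCyclotomic E hΔ hp2 ?_
  intro himg
  exact hng ⟨p, Fact.out, hp, himg⟩

/-- Off door 1, at `p = 3` (sharpened by the PROVED Prop. 9.1 (a)): some framing of `E[3]` is reducible or has
image EQUAL to a split-Cartan normaliser `C_s⁺(3)`. [cite: FreitasLeHungSiksek2015, Prop. 9.1 (a)] -/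
theorem mod3_dichotomy_of_not_generic {K₀ : Type} [Field K₀] [NumberField K₀] [IsTotallyReal K₀]
    (E : WeierstrassCurve (𝓞 K₀)) (hΔ : E.Δ ≠ 0) (hng : ¬ Generic357 K₀ E) :
    ∃ ρ : ModPGaloisRep K₀ (ZMod 3) 2, (E.baseChange K₀).IsTorsionGaloisRep 3 ρ ∧
      (¬ FramedRep.IsIrreducible ρ ∨
        ∃ P : GL (Fin 2) (ZMod 3), ρ.toMonoidHom.range =
          Subgroup.normalizer (Serre1972.splitCartan P : Set (GL (Fin 2) (ZMod 3)))) := by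
  haveI := FLS2015.isElliptic_baseChange hΔ
  have h3 : ¬ ModPImageAbsIrreducibleOverCyclotomic (E.baseChange K₀) 3 :=
    fun himg => hng ⟨3, Fact.out, Or.inl rfl, himg⟩
  obtain ⟨ρ, hρ, L, _, _, _, hred⟩ :
      ∃ ρ : ModPGaloisRep K₀ (ZMod 3) 2, (E.baseChange K₀).IsTorsionGaloisRep 3 ρ ∧
        ∃ (L : Type) (_ : Field L) (_ : Algebra K₀ L) (_ : IsCyclotomicExtension {3} K₀ L),
          ¬ FramedRep.IsAbsolutelyIrreducible (FramedGaloisRep.restrictField L ρ) := by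
    by_contra hall
    push Not at hall
    exact h3 fun ρ hρ L _ _ _ => hall ρ hρ L inferInstance inferInstance inferInstance
  by_cases hirr : FramedRep.IsIrreducible ρ
  · exact ⟨ρ, hρ, Or.inr (FLS2015.prop9_1a_of_isTorsionGaloisRep (E.baseChange K₀) hρ hirr L hred)⟩
  · exact ⟨ρ, hρ, Or.inl hirr⟩

/-- On door 1's complement the Skinner–Wiles locus needs only three of its four clauses (the second is automatic). -/
theorem swLocus_of_not_generic {K₀ : Type} [Field K₀] [NumberField K₀] (E : WeierstrassCurve (𝓞 K₀))
    (hng : ¬ Generic357 K₀ E) (p : ℕ) [Fact p.Prime] (hp : p = 3 ∨ p = 5 ∨ p = 7)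
    (h1 : ModPAbsIrreducible K₀ E p) (h3 : PotMultAbove K₀ E p) (h4 : NoLocalMuAbove K₀ p) : SWLocus K₀ E p :=
  ⟨h1, fun himg => hng ⟨p, Fact.out, hp, himg⟩, h3, h4⟩

/-! ## §5 Compositions by name: up to LJR, REST_E and REST (stmt-Langlands-26998) -/

/-- KERNEL up to LJR: ADC (g28's print junction) → FLS34 → SWD → PZD → CORE → LJR, through g28's
`largeJResidual_of_sectors` BY NAME (g29's DESC / F2T_anch transport is not needed on this cut). -/
theorem largeJResidual_of_core (hADC : AllenDyadicCorollary) (h34 : FLS2015_theorems3_4)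
    (hSW : SkinnerWilesDihedralDoor) (hPZ : PanZhangSupersingularDoor) (hC : CoreResidual) : LargeJResidual :=
  largeJResidual_of_sectors (allenDoorSector_of_corollary hADC) (residual_of_core h34 hSW hPZ hC)

/-- KERNEL up to REST_E, through the tree's `JDegreeFilterSplit.restE_of_jLeaves`. -/
theorem restE_of_core (hDBC : RatBaseChangeModularity) (hNSBC : SmallFieldBaseChange)
    (hFLS : FLS2015_theorem1) (hDNS : DNS2020_theorem4) (hBox : Box2022_theorem1_1)
    (hADC : AllenDyadicCorollary) (h34 : FLS2015_theorems3_4) (hSW : SkinnerWilesDihedralDoor)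
    (hPZ : PanZhangSupersingularDoor) (hC : CoreResidual) : UnanchoredHighDegreeModularE :=
  restE_of_jLeaves hDBC hNSBC hFLS hDNS hBox (largeJResidual_of_core hADC h34 hSW hPZ hC)

/-- KERNEL COMPOSITION concluding REST = `TowerDoorSplit.UnanchoredHighDegreeWitnessAutomorphy`
(stmt-Langlands-26998) BY NAME, through the tree's `JDegreeFilterSplit.closes_target`. -/
theorem closes_target (hDBC : RatBaseChangeModularity) (hNSBC : SmallFieldBaseChange)
    (hFLS : FLS2015_theorem1) (hDNS : DNS2020_theorem4) (hBox : Box2022_theorem1_1)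
    (hADC : AllenDyadicCorollary) (h34 : FLS2015_theorems3_4) (hSW : SkinnerWilesDihedralDoor)
    (hPZ : PanZhangSupersingularDoor) (hC : CoreResidual) (hIMT : IntegralModelTransferPointwise)
    (hTr : Summit.Langlands.Langlands.Theses.EllipticDegreeLadder.EllipticTransportAnyBase)
    (hW : SatakeAvatarTwo)
    (h1 : Summit.Langlands.Langlands.Theses.EllipticDegreeLadder.RankOneAutomorphy) :
    Summit.Langlands.Langlands.Theses.TowerDoorSplit.UnanchoredHighDegreeWitnessAutomorphy :=
  Summit.Langlands.Langlands.Theorems.JDegreeFilterSplit.closes_target hDBC hNSBC hFLS hDNS hBox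
    (largeJResidual_of_core hADC h34 hSW hPZ hC) hIMT hTr hW h1

/-- `closes_target` with W⁺ the host item `SatakeAvatarExistence` (stmt-Langlands-17415) BY NAME. -/
theorem closes_byName (hDBC : RatBaseChangeModularity) (hNSBC : SmallFieldBaseChange)
    (hFLS : FLS2015_theorem1) (hDNS : DNS2020_theorem4) (hBox : Box2022_theorem1_1)
    (hADC : AllenDyadicCorollary) (h34 : FLS2015_theorems3_4) (hSW : SkinnerWilesDihedralDoor)
    (hPZ : PanZhangSupersingularDoor) (hC : CoreResidual) (hIMT : IntegralModelTransferPointwise)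
    (hTr : Summit.Langlands.Langlands.Theses.EllipticDegreeLadder.EllipticTransportAnyBase)
    (hW : Summit.Langlands.Langlands.Theses.EllipticDegreeLadder.SatakeAvatarExistence)
    (h1 : Summit.Langlands.Langlands.Theses.EllipticDegreeLadder.RankOneAutomorphy) :
    Summit.Langlands.Langlands.Theses.TowerDoorSplit.UnanchoredHighDegreeWitnessAutomorphy :=
  closes_target hDBC hNSBC hFLS hDNS hBox hADC h34 hSW hPZ hC hIMT hTr (satakeAvatarTwo_of_host hW) h1

/-! ### Necessity from the lineage targets (the trivial direction) -/

/-- LJR ⇒ CORE. -/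
theorem core_of_largeJResidual (h : LargeJResidual) : CoreResidual :=
  core_of_residual (residual_of_largeJResidual h)

/-- REST_E ⇒ CORE. -/
theorem core_of_restE (h : UnanchoredHighDegreeModularE) : CoreResidual :=
  core_of_largeJResidual (largeJResidual_of_restE h)

end Summit.Langlands.Langlands.Theorems.OddPrimeDoorSplit
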